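import Literature.NumberTheory.GaloisRepresentations.GlobalReciprocityLimitFormProofs
import Literature.NumberTheory.GaloisRepresentations.LocalReciprocityLimitProofs
import Literature.NumberTheory.Automorphic.ClassFieldCharacter
import Mathlib.FieldTheory.Galois.Profinite
import HarnessLib

/-!
# The global reciprocity law (7.12) from the finite-level reciprocity law (6.13) and the
existence theorem (7.8): the universal norm residue symbol `( , K) = lim ( , L|K)`

Topic `NumberTheory/GaloisRepresentations`; namespace `Literature.NumberTheory.GaloisRepresentations`.
Fourth proof file of `GlobalReciprocity.lean` (after `GlobalReciprocityProofs`,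
`Automorphic/IdeleClassGroupDivisibleProofs`, `GlobalReciprocityLimitFormProofs`).  Everything here
is **proved**; no named facts are introduced.

`GlobalReciprocityLimitFormProofs` reduced the named fact `exists_isGlobalReciprocityMap K`
(Neukirch, *Class Field Theory — The Bonn Lectures*, Part III, Thm. (7.12)) for `K : Type` to the
**Artin map in limit form**: a continuous `θ : C_K →* Γ_K^ab` with dense range such that every
open subgroup of finite index of `C_K` is `θ⁻¹(H)` for an open `H ≤ Γ_K^ab`
(`exists_isGlobalReciprocityMap_iff_artinMapLimitForm`).  This file performs the remaining
*formal* step of Neukirch's text, the **passage to the limit** (Part III §6, p. 169–170, with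
Part II (1.15); continuity as in the proof of (7.12), p. 184): it derives the Artin map in limit
form — hence (7.12) — from the two finite-level theorems of global class field theory *as
printed*,

* **(6.13) Theorem** (Artin reciprocity law, p. 167). *The sequence
  `1 → N_{L|K} C_L → C_K —( , L|K)→ G_{L|K}^ab → 1` is exact*, together with the compatibility
  **(6.13 a)**: for `N ⊇ L ⊇ K`, *`(ā, L|K) = π (ā, N|K)`*, `π : G_{N|K}^ab → G_{L|K}^ab` the
  projection;
* **(7.8) Existence Theorem** (p. 178). *The norm groups of `C_K` are precisely the closed
  subgroups of finite index* (norm group: `𝒩_L = N_{L|K} C_L`, p. 168; by (6.14) every norm group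
  is the norm group of an abelian extension),

exactly as the local theory of the tree passes from Serre's finite-level reciprocity system
(`LocalReciprocityFinite`) to `θ_F : Fˣ → Γ_F^ab` (`LocalReciprocityLimitProofs`).

## Contents

*Generic layer* (any field `F`, any group `A`; §1 — the construction of
`LocalReciprocityLimitProofs` (`IsReciprocitySystem.theta`, there for `A = Fˣ`, `F` local) run
verbatim): a family `ω_L : A →* G(L|F)` indexed by the finite abelian subextensions `L` of
`F̄ = AlgebraicClosure F`, compatible in towers (`IsCompatibleSystem F ω` = (6.13 a)), has a limit
`IsCompatibleSystem.theta : A →* Γ_F^ab = Γ_F ⧸ closure [Γ_F, Γ_F]` characterised by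
`[γ] = θ x ⟺ γ|_L = ω_L x` for all finite abelian `L` (`absGaloisAbProj_eq_theta_iff`; existence of
representatives by compactness of `Γ_F`, uniqueness by
`absoluteGaloisGroup.mem_topologicalClosure_commutator_iff`, i.e. `Γ_F^ab = G(F^ab|F)`), and

* `theta_eq_one_iff` — `θ x = 1 ⟺ ω_L x = 1` for all `L` (kernel `= ⋂_L ker ω_L`);
* `denseRange_theta` — if every `ω_L` is surjective, `θ` has dense image (Neukirch II (1.15));
* `continuous_theta` — if `A` is a topological group and every `ker ω_L` is open, `θ` is
  continuous (proof of (7.12), p. 184);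
* `comap_theta_abelianizedFixingSubgroup` — `θ⁻¹(G(F^ab|L)) = ker ω_L`, with `G(F^ab|L)` (the
  image of `Gal(F̄|L)` in `Γ_F^ab`) open.

*Number fields* (§2): `normClassGroup K L = N_{L|K} C_L ≤ C_K` (the image of the tree's
`Automorphic.normGroup K L = K^× N(𝕀_L) ≤ 𝕀_K` in `C_K`); the predicate
`IsGlobalReciprocitySystem K ω` = (6.13) with (6.13 a) for the finite abelian `L ⊆ K̄`
(`ω_L : C_K →* G(L|K)` surjective, `ker ω_L = N_{L|K} C_L`, compatible); and, writing `(7.8)` for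
the hypothesis "a subgroup of `C_K` is some `N_{L|K} C_L`, `L|K` finite abelian in `K̄`, iff it is
closed of finite index":

* `IsGlobalReciprocitySystem.denseRange_theta`, `.theta_eq_one_iff` — the universal norm residue
  symbol `( , K) = lim ( , L|K)` has dense image and kernel `D_K = ⋂_L N_{L|K} C_L` (p. 170);
* `IsGlobalReciprocitySystem.continuous_theta` ((7.8) ⇒ norm groups open ⇒ continuity, p. 184),
  `.exists_isOpen_comap_eq` ((7.8) ⇒ every open finite-index subgroup is `θ⁻¹(G(K^ab|L))`);
* `IsGlobalReciprocitySystem.isGlobalReciprocityMap_theta` — **for `K : Type`, (6.13) + (7.8) imply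
  that `( , K)` is a global reciprocity map** ((7.12): continuous, surjective, kernel the
  infinitely divisible classes, existence theorem in limit form), the topological half of the
  proof of (7.12) being the tree's `IsGlobalReciprocityMap.of_denseRange₁`; hence
  `exists_isGlobalReciprocityMap_of_isGlobalReciprocitySystem`;
* universe-polymorphic forms: `IsGlobalReciprocitySystem.artinMapLimitForm` and
  `.isGlobalReciprocityMap_theta'` (the decomposition `C_K = (compact)·(divisible)` and the
  divisibility of `⋂ {open finite-index subgroups}` kept as hypotheses, as in
  `IsGlobalReciprocityMap.of_denseRange`).

What remains between the tree and `exists_isGlobalReciprocityMap_holds` is therefore global class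
field theory proper at finite level — a system `ω` with `IsGlobalReciprocitySystem K ω` (Artin
reciprocity (6.13): idele class cohomology, first and second inequalities, invariant map and
class formation (6.8)–(6.9), Tate–Nakayama) and the existence theorem (7.8) (Kummer theory
(7.7)) — and nothing formal or topological.

## Faithfulness notes

* As in `LocalReciprocityFinite`, the index set of a system is the type of all intermediate
  fields of `K̄|K`; the clauses constrain only the finite abelian ones.  Neukirch indexes
  `( , L|K)` by finite normal `L` with values in `G_{L|K}^ab`; by (6.13 a) with `L ↦ L^ab`
  (`G_{L|K}^ab = G_{L^ab|K}`) and (6.14) (`N_{L|K}C_L = N_{L^ab|K}C_{L^ab}`) the abelian levels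
  carry the same information, and only they enter `lim_L G_{L|K}^ab = G_K^ab` (p. 169–170).
* Compatibility (6.13 a) is phrased through lifts to `Γ_K` (any `γ ∈ Γ_K` restricting to
  `(ā, L'|K)` on `L'` restricts to `(ā, L|K)` on `L ⊆ L'`), which is equivalent since
  `Γ_K → G(L'|K)` is onto and `π` is restriction.
* The norm group `N_{L|K} C_L` is rendered as the image in `C_K = 𝕀_K ⧸ Kˣ` of the tree's idelic
  norm group `Automorphic.normGroup K L = Kˣ · N_{L|K}(𝕀_L)` (`ClassFieldCharacter.lean`; Tate's
  `K^* N_{L/K} J_L`, Cassels–Fröhlich VII §5.1 (B)); the `NumberField` structure on a finite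
  subextension `L ⊆ K̄` is `NumberField.of_module_finite` (a proposition, so the choice is
  irrelevant).
* (7.8) is used as a hypothesis in its printed form (norm groups `=` closed subgroups of finite
  index), restricted to norm groups of finite abelian `L ⊆ K̄` as explained above; "closed of
  finite index" and "open of finite index" agree for subgroups of a topological group
  (`Subgroup.isOpen_of_isClosed_of_finiteIndex`, `Subgroup.isClosed_of_isOpen`).

## References

* J. Neukirch, *Class Field Theory — The Bonn Lectures* (ed. A. Schmidt), Springer 2013, Part III
  §6: (6.13) with compatibility a), (6.14), the universal norm residue symbol (p. 169–170);
  §7: (7.8), Thm. (7.12) and its proof (p. 182–184); Part II (1.15). [Neukirch2013]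
* J. Tate, *Global class field theory*, Ch. VII of Cassels–Fröhlich, *Algebraic Number Theory*
  (1967), §5.1 Main Theorem (B), (D), §5.4–5.6. [CasselsFrohlichANT1967]
-/

noncomputable section

open Field Topology
open scoped Pointwise

namespace Literature.NumberTheory.GaloisRepresentations

universe u v

/-! ### §1. Compatible systems of finite-level symbols and their limit (any field) -/

section CompatibleSystem

variable (F : Type u) [Field F] {A : Type v} [Group A]

/-- `IsCompatibleSystem F ω`: the family of homomorphisms `ω_L : A →* G(L|F)`, indexed by the
subextensions `L` of `F̄|F`, is **compatible in towers** of finite abelian subextensions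
`L ⊆ L'`: `ω_L x` is the restriction of `ω_{L'} x` — phrased through lifts to `Γ_F`: any
`γ ∈ Γ_F` restricting to `ω_{L'} x` on `L'` restricts to `ω_L x` on `L`.  This is Neukirch's
compatibility (6.13 a) of the norm residue symbols, *"`(ā, L|K) = π(ā, N|K)` … Here `π` is the
canonical projection of `G_{N|K}^ab` onto `G_{L|K}^ab`"*, the property that makes the universal
symbol `(ā, K) = lim (ā, L|K)` well defined (p. 170); cf. Serre, *Local Fields* XIII §4 Prop. 12
(`LocalReciprocityFinite.IsReciprocitySystem.compatible`).
[cite: Neukirch2013, Part III (6.13) a), p. 167] -/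
structure IsCompatibleSystem
    (ω : (L : IntermediateField F (AlgebraicClosure F)) → A →* (L ≃ₐ[F] L)) : Prop where
  /-- Compatibility in towers `L ⊆ L'` of finite abelian subextensions.
  Ref: Neukirch, Bonn Lectures, III (6.13) a). -/
  compatible : ∀ (L L' : IntermediateField F (AlgebraicClosure F)) [FiniteDimensional F L]
    [IsAbelianGalois F L] [FiniteDimensional F L'] [IsAbelianGalois F L'], L ≤ L' →
    ∀ (x : A) (γ : absoluteGaloisGroup F),
      AlgEquiv.restrictNormalHom L' (absoluteGaloisGroup.toAlgEquiv F γ) = ω L' x →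
      AlgEquiv.restrictNormalHom L (absoluteGaloisGroup.toAlgEquiv F γ) = ω L x

/-- The image of `Gal(F̄|L)` in `Γ_F^ab = Γ_F ⧸ closure [Γ_F, Γ_F]`, for a subextension `L` of
`F̄|F`: the subgroup `G(F^ab | L ∩ F^ab)` of `G(F^ab|F)`, which is `G(F^ab|L)` for `L|F` abelian.
[folklore] -/
def abelianizedFixingSubgroup (L : IntermediateField F (AlgebraicClosure F)) :
    Subgroup (absoluteGaloisGroupAbelianization F) :=
  (L.fixingSubgroup.comap (absoluteGaloisGroup.toAlgEquiv F).toMonoidHom).map (absGaloisAbProj F)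

variable {F}

/-- Membership in `abelianizedFixingSubgroup F L`: the classes of the `σ ∈ Γ_F` fixing `L`
pointwise. [folklore] -/
theorem mem_abelianizedFixingSubgroup_iff (L : IntermediateField F (AlgebraicClosure F))
    (g : absoluteGaloisGroupAbelianization F) :
    g ∈ abelianizedFixingSubgroup F L ↔
      ∃ σ : absoluteGaloisGroup F, absoluteGaloisGroup.toAlgEquiv F σ ∈ L.fixingSubgroup ∧
        absGaloisAbProj F σ = g := by
  simp only [abelianizedFixingSubgroup, Subgroup.mem_map, Subgroup.mem_comap,
    MulEquiv.coe_toMonoidHom]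

/-- `G(F^ab|L)` is open in `Γ_F^ab` for `L|F` finite (`Gal(F̄|L)` is open in the Krull topology and
`Γ_F → Γ_F^ab` is an open map). [folklore] -/
theorem isOpen_abelianizedFixingSubgroup (L : IntermediateField F (AlgebraicClosure F))
    [FiniteDimensional F L] :
    IsOpen (abelianizedFixingSubgroup F L : Set (absoluteGaloisGroupAbelianization F)) :=
  QuotientGroup.isOpenMap_coe _ L.fixingSubgroup_isOpen

namespace IsCompatibleSystem

variable {ω : (L : IntermediateField F (AlgebraicClosure F)) → A →* (L ≃ₐ[F] L)}

/-- The representatives of `θ x` in `Γ_F`: the `γ` with `γ|_L = ω_L x` for every finite abelian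
`L` (the "compatible system formed by the elements `(ā, L|K)`", Neukirch p. 170). [folklore] -/
def Reps (_hω : IsCompatibleSystem F ω) (x : A) : Set (absoluteGaloisGroup F) :=
  {γ | ∀ (L : IntermediateField F (AlgebraicClosure F)) [FiniteDimensional F L]
    [IsAbelianGalois F L],
    AlgEquiv.restrictNormalHom L (absoluteGaloisGroup.toAlgEquiv F γ) = ω L x}

/-- Membership in `Reps`. [folklore] -/
theorem mem_reps_iff (hω : IsCompatibleSystem F ω) {x : A} {γ : absoluteGaloisGroup F} :
    γ ∈ hω.Reps x ↔ ∀ (L : IntermediateField F (AlgebraicClosure F)) [FiniteDimensional F L]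
      [IsAbelianGalois F L],
      AlgEquiv.restrictNormalHom L (absoluteGaloisGroup.toAlgEquiv F γ) = ω L x :=
  Iff.rfl

/-- Representatives multiply: `Reps x · Reps y ⊆ Reps (x y)`. [folklore] -/
theorem mul_mem_reps (hω : IsCompatibleSystem F ω) {x y : A} {γ δ : absoluteGaloisGroup F}
    (hγ : γ ∈ hω.Reps x) (hδ : δ ∈ hω.Reps y) : γ * δ ∈ hω.Reps (x * y) := by
  intro L _ _
  rw [map_mul, map_mul, map_mul, hγ L, hδ L]

/-- `1 ∈ Reps 1`. [folklore] -/
theorem one_mem_reps (hω : IsCompatibleSystem F ω) : (1 : absoluteGaloisGroup F) ∈ hω.Reps 1 := by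
  intro L _ _
  rw [map_one, map_one, map_one]

/-- `1 ∈ Reps x` iff `ω_L x = 1` for every finite abelian `L`. [folklore] -/
theorem one_mem_reps_iff (hω : IsCompatibleSystem F ω) {x : A} :
    (1 : absoluteGaloisGroup F) ∈ hω.Reps x ↔
      ∀ (L : IntermediateField F (AlgebraicClosure F)) [FiniteDimensional F L]
        [IsAbelianGalois F L], ω L x = 1 := by
  refine ⟨fun h L _ _ => ?_, fun h L _ _ => ?_⟩
  · have h1 := h L
    rw [map_one, map_one] at h1
    exact h1.symm
  · change AlgEquiv.restrictNormalHom L (absoluteGaloisGroup.toAlgEquiv F 1) = ω L x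
    rw [map_one, map_one]
    exact (h L).symm

/-- Two representatives of the same `x` differ by an element of `closure [Γ_F, Γ_F]` (they agree
on every finite abelian `L`; `absoluteGaloisGroup.mem_topologicalClosure_commutator_iff`), and
conversely. [folklore] -/
theorem mem_reps_iff_of_mem (hω : IsCompatibleSystem F ω) {x : A} {γ₀ γ : absoluteGaloisGroup F}
    (hγ₀ : γ₀ ∈ hω.Reps x) :
    γ ∈ hω.Reps x ↔ γ₀⁻¹ * γ ∈ (commutator (absoluteGaloisGroup F)).topologicalClosure := by
  rw [absoluteGaloisGroup.mem_topologicalClosure_commutator_iff]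
  constructor
  · intro hγ L _ _
    rw [← IntermediateField.restrictNormalHom_ker L, MonoidHom.mem_ker, map_mul, map_inv,
      map_mul, map_inv, hγ₀ L, hγ L, inv_mul_cancel]
  · intro h L _ _
    have h1 := h L
    rw [← IntermediateField.restrictNormalHom_ker L, MonoidHom.mem_ker, map_mul, map_inv,
      map_mul, map_inv, hγ₀ L, inv_mul_eq_one] at h1
    exact h1.symm

/-- **Existence of representatives** (the limit exists): for every `x` some `γ ∈ Γ_F` restricts
to `ω_L x` on every finite abelian `L` — finitely many conditions are met at once on the (finite
abelian) compositum by `compatible` and the surjectivity of `Γ_F → G(L|F)`, and `Γ_F` is compact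
(each condition is closed: `IsReciprocitySystem.isClosed_setOf_restrictNormalHom_eq` of
`LocalReciprocityLimitProofs`, valid for every field).
This is the statement that the compatible system `((ā, L|K))_L` is an element of
`lim G_{L|K} = G_K^ab` (Neukirch p. 169–170). [folklore] -/
theorem reps_nonempty (hω : IsCompatibleSystem F ω) (x : A) : (hω.Reps x).Nonempty := by
  classical
  haveI : CompactSpace (absoluteGaloisGroup F) := absoluteGaloisGroup_compactSpace F
  -- the closed conditions, indexed by the finite abelian `L`
  let ι := {L : IntermediateField F (AlgebraicClosure F) //
    FiniteDimensional F L ∧ IsAbelianGalois F L}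
  let Z : ι → Set (absoluteGaloisGroup F) := fun i =>
    haveI := i.2.1; haveI := i.2.2
    {γ | AlgEquiv.restrictNormalHom i.1 (absoluteGaloisGroup.toAlgEquiv F γ) = ω i.1 x}
  have hZ : ∀ i, IsClosed (Z i) := fun i => by
    haveI := i.2.1; haveI := i.2.2
    exact IsReciprocitySystem.isClosed_setOf_restrictNormalHom_eq i.1 (ω i.1 x)
  -- it suffices that `⋂ Z i` is nonempty
  suffices h : (Set.univ ∩ ⋂ i, Z i).Nonempty by
    obtain ⟨γ, -, hγ⟩ := h
    refine ⟨γ, fun L hL hL' => ?_⟩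
    have := Set.mem_iInter.mp hγ ⟨L, hL, hL'⟩
    exact this
  by_contra hempty
  rw [Set.not_nonempty_iff_eq_empty] at hempty
  obtain ⟨t, ht⟩ := isCompact_univ.elim_finite_subfamily_closed Z hZ hempty
  -- the compositum of the finitely many `L ∈ t` is finite abelian
  let M : IntermediateField F (AlgebraicClosure F) := t.sup fun i => i.1
  have hM : FiniteDimensional F M ∧ IsAbelianGalois F M := by
    refine Finset.sup_induction (p := fun N : IntermediateField F (AlgebraicClosure F) =>
      FiniteDimensional F N ∧ IsAbelianGalois F N) ⟨inferInstance, inferInstance⟩ ?_ ?_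
    · rintro N₁ ⟨h₁, h₁'⟩ N₂ ⟨h₂, h₂'⟩
      haveI := h₁; haveI := h₁'; haveI := h₂; haveI := h₂'
      exact ⟨inferInstance, isAbelianGalois_sup N₁ N₂⟩
    · intro i _
      exact i.2
  haveI := hM.1
  haveI := hM.2
  -- a `γ` with `γ|_M = ω_M x` works for every `L ∈ t`
  obtain ⟨g, hg⟩ := AlgEquiv.restrictNormalHom_surjective (AlgebraicClosure F) (ω M x)
  have hγ : (absoluteGaloisGroup.toAlgEquiv F).symm g ∈ Set.univ ∩ ⋂ i ∈ t, Z i := by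
    refine ⟨Set.mem_univ _, Set.mem_iInter₂.mpr fun i hi => ?_⟩
    haveI := i.2.1; haveI := i.2.2
    change AlgEquiv.restrictNormalHom i.1
      (absoluteGaloisGroup.toAlgEquiv F ((absoluteGaloisGroup.toAlgEquiv F).symm g)) = ω i.1 x
    rw [MulEquiv.apply_symm_apply]
    exact hω.compatible i.1 M (Finset.le_sup (f := fun i : ι => i.1) hi) x
      ((absoluteGaloisGroup.toAlgEquiv F).symm g) (by rw [MulEquiv.apply_symm_apply]; exact hg)
  rw [ht] at hγ
  exact hγ

/-- **The limit homomorphism** `θ : A →* Γ_F^ab = Γ_F ⧸ closure [Γ_F, Γ_F]` of a compatible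
system: `θ x` is the class of any representative `γ ∈ Reps x` (`reps_nonempty`; well defined and
multiplicative by `mem_reps_iff_of_mem`, `mul_mem_reps`).  For Neukirch's norm residue symbols
this is the universal norm residue symbol *"`(ā, K) = lim (ā, L|K) ∈ G_K^ab` … This yields a
homomorphism `C_K → G_K^ab`"* (p. 170). [cite: Neukirch2013, Part III §6, p. 169–170] -/
def theta (hω : IsCompatibleSystem F ω) : A →* absoluteGaloisGroupAbelianization F where
  toFun x := absGaloisAbProj F (hω.reps_nonempty x).some
  map_one' := by
    have h := (hω.mem_reps_iff_of_mem (hω.reps_nonempty 1).some_mem).mp hω.one_mem_reps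
    rw [mul_one] at h
    exact (QuotientGroup.eq_one_iff _).mpr ((Subgroup.inv_mem_iff _).mp h)
  map_mul' x y := by
    have h := (hω.mem_reps_iff_of_mem (hω.reps_nonempty (x * y)).some_mem).mp
      (hω.mul_mem_reps (hω.reps_nonempty x).some_mem (hω.reps_nonempty y).some_mem)
    rw [← map_mul]
    exact (QuotientGroup.eq.mpr h)

/-- **Characterisation of `θ`**: `[γ] = θ x` in `Γ_F^ab` iff `γ` restricts to `ω_L x` on every
finite abelian `L`. [folklore] -/
theorem absGaloisAbProj_eq_theta_iff (hω : IsCompatibleSystem F ω) {x : A}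
    {γ : absoluteGaloisGroup F} : absGaloisAbProj F γ = hω.theta x ↔ γ ∈ hω.Reps x := by
  change absGaloisAbProj F γ = absGaloisAbProj F (hω.reps_nonempty x).some ↔ _
  rw [hω.mem_reps_iff_of_mem (hω.reps_nonempty x).some_mem, eq_comm]
  exact QuotientGroup.eq

/-- `θ x` restricted to a finite abelian `L` is `ω_L x`, for any representative. [folklore] -/
theorem restrictNormalHom_eq_of_absGaloisAbProj_eq (hω : IsCompatibleSystem F ω) {x : A}
    {γ : absoluteGaloisGroup F} (h : absGaloisAbProj F γ = hω.theta x)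
    (L : IntermediateField F (AlgebraicClosure F)) [FiniteDimensional F L] [IsAbelianGalois F L] :
    AlgEquiv.restrictNormalHom L (absoluteGaloisGroup.toAlgEquiv F γ) = ω L x :=
  (hω.absGaloisAbProj_eq_theta_iff.mp h) L

/-- Every `θ x` has a representative in `Γ_F`. [folklore] -/
theorem exists_absGaloisAbProj_eq_theta (hω : IsCompatibleSystem F ω) (x : A) :
    ∃ γ : absoluteGaloisGroup F, absGaloisAbProj F γ = hω.theta x ∧ γ ∈ hω.Reps x :=
  ⟨_, rfl, (hω.reps_nonempty x).some_mem⟩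

/-- **The kernel of the limit map**: `θ x = 1` iff `ω_L x = 1` for every finite abelian `L`
(`ker θ = ⋂_L ker ω_L`; for the norm residue symbols: *"whose kernel is the intersection of all
norm groups"*, Neukirch p. 170). [cite: Neukirch2013, Part III §6, p. 170] -/
theorem theta_eq_one_iff (hω : IsCompatibleSystem F ω) {x : A} :
    hω.theta x = 1 ↔ ∀ (L : IntermediateField F (AlgebraicClosure F)) [FiniteDimensional F L]
      [IsAbelianGalois F L], ω L x = 1 := by
  have h1 : hω.theta x = 1 ↔ absGaloisAbProj F 1 = hω.theta x := by rw [map_one, eq_comm]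
  exact h1.trans (hω.absGaloisAbProj_eq_theta_iff.trans hω.one_mem_reps_iff)

/-- An open normal subgroup `N` of `Γ_F` gives a finite abelian `L ⊆ F̄` with
`Gal(F̄|L) = N · closure [Γ_F, Γ_F]`. [folklore] -/
theorem exists_isAbelianGalois_fixingSubgroup_eq_sup (N : OpenNormalSubgroup (absoluteGaloisGroup F)) :
    ∃ L : IntermediateField F (AlgebraicClosure F), FiniteDimensional F L ∧ IsAbelianGalois F L ∧
      L.fixingSubgroup = ((N.toSubgroup ⊔ (commutator (absoluteGaloisGroup F)).topologicalClosure :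
        Subgroup (absoluteGaloisGroup F)) :
          Subgroup (AlgebraicClosure F ≃ₐ[F] AlgebraicClosure F)) := by
  haveI : N.toSubgroup.Normal := N.isNormal'
  haveI : (N.toSubgroup ⊔ (commutator (absoluteGaloisGroup F)).topologicalClosure).Normal :=
    Subgroup.sup_normal _ _
  refine absoluteGaloisGroup.exists_isAbelianGalois_fixingSubgroup_eq F _
    (Subgroup.isOpen_mono le_sup_left N.isOpen) fun a b => ?_
  exact Subgroup.mem_sup_right (Subgroup.le_topologicalClosure _
    (Subgroup.commutator_mem_commutator (Subgroup.mem_top a) (Subgroup.mem_top b)))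

/-- If `γ|_L = δ|_L` on the finite abelian `L` with `Gal(F̄|L) = N · closure [Γ_F, Γ_F]`, then
`[δ] = [γ n]` in `Γ_F^ab` for some `n ∈ N`. [folklore] -/
theorem exists_absGaloisAbProj_eq_mul (N : OpenNormalSubgroup (absoluteGaloisGroup F))
    {L : IntermediateField F (AlgebraicClosure F)} [FiniteDimensional F L] [IsAbelianGalois F L]
    (hL : L.fixingSubgroup = ((N.toSubgroup ⊔ (commutator (absoluteGaloisGroup F)).topologicalClosure :
        Subgroup (absoluteGaloisGroup F)) : Subgroup (AlgebraicClosure F ≃ₐ[F] AlgebraicClosure F)))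
    {γ δ : absoluteGaloisGroup F}
    (h : AlgEquiv.restrictNormalHom L (absoluteGaloisGroup.toAlgEquiv F γ) =
      AlgEquiv.restrictNormalHom L (absoluteGaloisGroup.toAlgEquiv F δ)) :
    ∃ n : absoluteGaloisGroup F, n ∈ (N : Set (absoluteGaloisGroup F)) ∧
      absGaloisAbProj F δ = absGaloisAbProj F (γ * n) := by
  have hmem : γ⁻¹ * δ ∈ N.toSubgroup ⊔ (commutator (absoluteGaloisGroup F)).topologicalClosure := by
    have h1 : absoluteGaloisGroup.toAlgEquiv F (γ⁻¹ * δ) ∈ L.fixingSubgroup := by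
      rw [← IntermediateField.restrictNormalHom_ker L, MonoidHom.mem_ker, map_mul, map_inv, map_mul,
        map_inv, h, inv_mul_cancel]
    rw [hL] at h1
    exact h1
  have hmem' : γ⁻¹ * δ ∈ ((N.toSubgroup : Set (absoluteGaloisGroup F)) *
      ((commutator (absoluteGaloisGroup F)).topologicalClosure : Set (absoluteGaloisGroup F))) := by
    rw [← Subgroup.mul_normal]
    exact hmem
  obtain ⟨n, hn, c, hc, hnc⟩ := Set.mem_mul.mp hmem'
  refine ⟨n, hn, ?_⟩
  have hδ : δ = γ * (n * c) := by rw [hnc, mul_inv_cancel_left]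
  rw [eq_comm]
  apply QuotientGroup.eq.mpr
  have h2 : (γ * n)⁻¹ * δ = c := by rw [hδ]; group
  rw [h2]
  exact hc

/-- **Dense image** (Neukirch II (1.15); p. 170: *"whose image is a dense subgroup of
`G_K^ab`"*): if every finite-level symbol `ω_L : A → G(L|F)` is surjective, the limit map
`θ : A → Γ_F^ab` has dense range.  Proof: a basic open set of `Γ_F^ab` around `[γ]` contains the
image of `γ N` for an open normal subgroup `N ≤ Γ_F`; with `L` finite abelian such that
`Gal(F̄|L) = N · closure [Γ_F, Γ_F]` and `ω_L a = γ|_L`, any representative `δ` of `θ a` satisfies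
`δ ∈ γ N · closure [Γ_F, Γ_F]`, so `θ a = [γ n]`. [cite: Neukirch2013, Part III §6, p. 170] -/
theorem denseRange_theta (hω : IsCompatibleSystem F ω)
    (hsurj : ∀ (L : IntermediateField F (AlgebraicClosure F)) [FiniteDimensional F L]
      [IsAbelianGalois F L], Function.Surjective (ω L)) :
    DenseRange hω.theta := by
  haveI : CompactSpace (absoluteGaloisGroup F) := absoluteGaloisGroup_compactSpace F
  rw [DenseRange, dense_iff_inter_open]
  rintro U hU ⟨p, hp⟩
  obtain ⟨γ, rfl⟩ : ∃ γ : absoluteGaloisGroup F, absGaloisAbProj F γ = p :=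
    QuotientGroup.mk_surjective p
  -- an open normal `N` with `γ N ⊆ mk⁻¹ U`
  have hVopen : IsOpen ((fun u : absoluteGaloisGroup F => γ * u) ⁻¹' ((absGaloisAbProj F) ⁻¹' U)) :=
    (hU.preimage
      (QuotientGroup.continuous_mk (N := (commutator (absoluteGaloisGroup F)).topologicalClosure))).preimage
      (continuous_const.mul continuous_id)
  have h1V : (1 : absoluteGaloisGroup F) ∈
      (fun u : absoluteGaloisGroup F => γ * u) ⁻¹' ((absGaloisAbProj F) ⁻¹' U) := by
    simpa only [Set.mem_preimage, mul_one] using hp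
  obtain ⟨N, hN⟩ := ProfiniteGrp.exist_openNormalSubgroup_sub_open_nhds_of_one hVopen h1V
  obtain ⟨L, hLfin, hLab, hLfix⟩ := exists_isAbelianGalois_fixingSubgroup_eq_sup N
  haveI := hLfin
  haveI := hLab
  obtain ⟨a, ha⟩ := hsurj L (AlgEquiv.restrictNormalHom L (absoluteGaloisGroup.toAlgEquiv F γ))
  obtain ⟨δ, hδθ, hδ⟩ := hω.exists_absGaloisAbProj_eq_theta a
  obtain ⟨n, hn, hδn⟩ := exists_absGaloisAbProj_eq_mul N hLfix ((hδ L).trans ha).symm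
  refine ⟨hω.theta a, ?_, a, rfl⟩
  rw [← hδθ, hδn]
  exact hN hn

/-- **Continuity** (Neukirch, proof of (7.12), p. 184: *"If `H` is an open subgroup of `G_K^ab` …
and `L` is the fixed field of `H`, then the norm group `𝒩_L ⊆ C_K` is open, and … it is mapped
by `( , K)` into `H`"*): if `A` is a topological group and every `ker ω_L` is open, the limit map
`θ` is continuous.  Proof: a neighbourhood of `1 ∈ Γ_F^ab` contains the image of an open normal
`N ≤ Γ_F`; with `L` as above, `θ` maps the open subgroup `ker ω_L` into the image of `N`.
[cite: Neukirch2013, Part III Thm. (7.12) (proof, p. 184)] -/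
theorem continuous_theta [TopologicalSpace A] [IsTopologicalGroup A] (hω : IsCompatibleSystem F ω)
    (hker : ∀ (L : IntermediateField F (AlgebraicClosure F)) [FiniteDimensional F L]
      [IsAbelianGalois F L], IsOpen ((ω L).ker : Set A)) :
    Continuous hω.theta := by
  haveI : CompactSpace (absoluteGaloisGroup F) := absoluteGaloisGroup_compactSpace F
  refine continuous_of_continuousAt_one hω.theta ?_
  rw [ContinuousAt, map_one, Filter.tendsto_def]
  intro U hU
  obtain ⟨U₀, hU₀U, hU₀open, h1⟩ := mem_nhds_iff.mp hU
  have hVopen : IsOpen ((absGaloisAbProj F) ⁻¹' U₀) :=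
    hU₀open.preimage
      (QuotientGroup.continuous_mk (N := (commutator (absoluteGaloisGroup F)).topologicalClosure))
  have h1V : (1 : absoluteGaloisGroup F) ∈ (absGaloisAbProj F) ⁻¹' U₀ := by
    simpa only [Set.mem_preimage, map_one] using h1
  obtain ⟨N, hN⟩ := ProfiniteGrp.exist_openNormalSubgroup_sub_open_nhds_of_one hVopen h1V
  obtain ⟨L, hLfin, hLab, hLfix⟩ := exists_isAbelianGalois_fixingSubgroup_eq_sup N
  haveI := hLfin
  haveI := hLab
  have hsub : ((ω L).ker : Set A) ⊆ hω.theta ⁻¹' U := fun a ha => by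
    obtain ⟨δ, hδθ, hδ⟩ := hω.exists_absGaloisAbProj_eq_theta a
    have h1δ : AlgEquiv.restrictNormalHom L (absoluteGaloisGroup.toAlgEquiv F 1) =
        AlgEquiv.restrictNormalHom L (absoluteGaloisGroup.toAlgEquiv F δ) := by
      rw [hδ L, map_one, map_one]
      exact (MonoidHom.mem_ker.mp ha).symm
    obtain ⟨n, hn, hδn⟩ := exists_absGaloisAbProj_eq_mul N hLfix h1δ
    rw [Set.mem_preimage, ← hδθ, hδn, one_mul]
    exact hU₀U (hN hn)
  exact Filter.mem_of_superset ((hker L).mem_nhds (one_mem _)) hsub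

/-- **`θ⁻¹(G(F^ab|L)) = ker ω_L`** for a finite abelian `L`: `θ x ∈` image of `Gal(F̄|L)` iff
some (every) representative of `θ x` fixes `L`, iff `ω_L x = (θ x)|_L = 1`.  For the norm residue
symbols: `( , K)⁻¹(G(K^ab|L)) = ker ( , L|K) = N_{L|K} C_L` (Neukirch p. 184:
*"`(𝒩_L, L|K) = (𝒩_L, K) · H = 1`"*). [folklore] -/
theorem comap_theta_abelianizedFixingSubgroup (hω : IsCompatibleSystem F ω)
    (L : IntermediateField F (AlgebraicClosure F)) [FiniteDimensional F L] [IsAbelianGalois F L] :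
    (abelianizedFixingSubgroup F L).comap hω.theta = (ω L).ker := by
  ext x
  rw [Subgroup.mem_comap, MonoidHom.mem_ker, mem_abelianizedFixingSubgroup_iff]
  constructor
  · rintro ⟨σ, hσ, hσx⟩
    rw [← hω.restrictNormalHom_eq_of_absGaloisAbProj_eq hσx L]
    have h : absoluteGaloisGroup.toAlgEquiv F σ ∈ (AlgEquiv.restrictNormalHom L).ker := by
      rw [IntermediateField.restrictNormalHom_ker]
      exact hσ
    exact h
  · intro hx
    obtain ⟨γ, hγθ, hγ⟩ := hω.exists_absGaloisAbProj_eq_theta x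
    refine ⟨γ, ?_, hγθ⟩
    rw [← IntermediateField.restrictNormalHom_ker L, MonoidHom.mem_ker, hγ L, hx]

end IsCompatibleSystem

end CompatibleSystem

/-! ### §2. Number fields: the norm residue symbols `( , L|K)` and `( , K) = lim ( , L|K)` -/

section NumberField

open NumberField

variable (K : Type u) [Field K] [NumberField K]

/-- **The norm group `N_{L|K} C_L ≤ C_K`** of a finite extension `L|K` of the number field `K`
(Neukirch p. 168: *"A subgroup `I` of the idèle class group `C_K` … is called a norm group if
there is a normal extension `L|K` with `I = N_{L|K} C_L`"*): the image in `C_K = 𝕀_K ⧸ Kˣ` of the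
idelic norm group `Kˣ · N_{L|K}(𝕀_L) ≤ 𝕀_K` of the tree (`Automorphic.normGroup K L`; Tate's
`K^* N_{L/K} J_L`).  The number-field structure of `L` is `NumberField.of_module_finite K L`.
[cite: Neukirch2013, Part III §6, p. 168] -/
def normClassGroup (L : Type v) [Field L] [Algebra K L] [FiniteDimensional K L] :
    Subgroup (ideleGroup K ⧸ principalIdeles K) :=
  haveI : NumberField L := NumberField.of_module_finite K L
  (Automorphic.normGroup K L).map (QuotientGroup.mk' (principalIdeles K))

/-- Unfolding `normClassGroup` for a number field `L` (any `NumberField L` instance).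
[folklore] -/
theorem normClassGroup_eq (L : Type v) [Field L] [NumberField L] [Algebra K L]
    [FiniteDimensional K L] :
    normClassGroup K L = (Automorphic.normGroup K L).map (QuotientGroup.mk' (principalIdeles K)) :=
  rfl

/-- Membership in `N_{L|K} C_L`: the classes of the ideles in `Kˣ · N_{L|K}(𝕀_L)`. [folklore] -/
theorem mem_normClassGroup_iff (L : Type v) [Field L] [NumberField L] [Algebra K L]
    [FiniteDimensional K L] (a : ideleGroup K ⧸ principalIdeles K) :
    a ∈ normClassGroup K L ↔
      ∃ x ∈ Automorphic.normGroup K L, (QuotientGroup.mk x : ideleGroup K ⧸ principalIdeles K) = a :=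
  Subgroup.mem_map

/-- The preimage of `N_{L|K} C_L` in `𝕀_K` is `Kˣ · N_{L|K}(𝕀_L)` (which contains `Kˣ`).
[folklore] -/
theorem comap_mk'_normClassGroup (L : Type v) [Field L] [NumberField L] [Algebra K L]
    [FiniteDimensional K L] :
    (normClassGroup K L).comap (QuotientGroup.mk' (principalIdeles K)) = Automorphic.normGroup K L := by
  rw [normClassGroup_eq, Subgroup.comap_map_eq, QuotientGroup.ker_mk',
    sup_eq_left.mpr (Automorphic.principalIdeles_le_normGroup K L)]

/-- `IsGlobalReciprocitySystem K ω`: the family `ω_L : C_K →* G(L|K)`, indexed by the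
subextensions `L` of `K̄|K`, has — on the finite abelian `L` — the printed properties of the
**norm residue symbols `( , L|K)`** of global class field theory:
* `compatible` (from `IsCompatibleSystem`): *(6.13 a)* `(ā, L|K) = π(ā, L'|K)` for `L ⊆ L'`;
* `surjective` and `ker_eq`: **(6.13) Theorem** (Artin reciprocity law). *The sequence
  `1 → N_{L|K} C_L → C_K —( , L|K)→ G_{L|K}^ab → 1` is exact* — `( , L|K)` is onto `G(L|K)`
  (`= G_{L|K}^ab`, `L|K` abelian) with kernel the norm group `N_{L|K} C_L = normClassGroup K L`
  (Tate, Cassels–Fröhlich VII §5.1 (B): *"ψ_{L/K} is surjective with kernel `K^* N_{L/K} J_L`"*).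
In the source `( , L|K)` is *the* inverse of the reciprocity isomorphism
`θ_{L|K} : G_{L|K}^ab ≅ C_K / N_{L|K} C_L` given by cup product with the fundamental class (6.12);
Lean has no construction of it, so the theorems are vendored as properties of a system `ω`.
[cite: Neukirch2013, Part III (6.13) with a), p. 167] [cite: CasselsFrohlichANT1967, Ch. VII §5.1 (B)] -/
structure IsGlobalReciprocitySystem
    (ω : (L : IntermediateField K (AlgebraicClosure K)) →
      (ideleGroup K ⧸ principalIdeles K) →* (L ≃ₐ[K] L)) : Prop
    extends IsCompatibleSystem K ω where
  /-- `( , L|K) : C_K → G(L|K)` is surjective.  Ref: Neukirch, Bonn Lectures, III (6.13). -/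
  surjective : ∀ (L : IntermediateField K (AlgebraicClosure K)) [FiniteDimensional K L]
    [IsAbelianGalois K L], Function.Surjective (ω L)
  /-- The kernel of `( , L|K)` is the norm group `N_{L|K} C_L`.  Ref: Neukirch, Bonn Lectures,
  III (6.13); Tate, Cassels–Fröhlich VII §5.1 (B). -/
  ker_eq : ∀ (L : IntermediateField K (AlgebraicClosure K)) [FiniteDimensional K L]
    [IsAbelianGalois K L], (ω L).ker = normClassGroup K L

namespace IsGlobalReciprocitySystem

variable {K}
variable {ω : (L : IntermediateField K (AlgebraicClosure K)) →
  (ideleGroup K ⧸ principalIdeles K) →* (L ≃ₐ[K] L)}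

/-- **The universal norm residue symbol has dense image** (Neukirch p. 170, from II (1.15)):
`( , K) = lim ( , L|K) : C_K → G_K^ab` (`= hω.theta`) has dense range, because every `( , L|K)`
is surjective (6.13). [cite: Neukirch2013, Part III §6, p. 170] -/
theorem denseRange_theta (hω : IsGlobalReciprocitySystem K ω) : DenseRange hω.theta :=
  hω.toIsCompatibleSystem.denseRange_theta hω.surjective

/-- **The kernel of the universal norm residue symbol is `D_K = ⋂_L N_{L|K} C_L`** (Neukirch
p. 170: *"whose kernel is the intersection of all norm groups"*; (7.12): `D_K = ⋂_L N_{L|K}C_L`),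
the intersection over the finite abelian `L ⊆ K̄` (which suffices by (6.14)).
[cite: Neukirch2013, Part III §6, p. 170] -/
theorem theta_eq_one_iff (hω : IsGlobalReciprocitySystem K ω) {a : ideleGroup K ⧸ principalIdeles K} :
    hω.theta a = 1 ↔ ∀ (L : IntermediateField K (AlgebraicClosure K)) [FiniteDimensional K L]
      [IsAbelianGalois K L], a ∈ normClassGroup K L := by
  rw [hω.toIsCompatibleSystem.theta_eq_one_iff]
  refine ⟨fun h L _ _ => ?_, fun h L _ _ => ?_⟩
  · rw [← hω.ker_eq L]
    exact h L
  · exact (hω.ker_eq L).ge (h L)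

/-- `( , K)⁻¹(G(K^ab|L)) = N_{L|K} C_L` for `L|K` finite abelian (p. 184). [folklore] -/
theorem comap_theta_eq_normClassGroup (hω : IsGlobalReciprocitySystem K ω)
    (L : IntermediateField K (AlgebraicClosure K)) [FiniteDimensional K L] [IsAbelianGalois K L] :
    (abelianizedFixingSubgroup K L).comap hω.theta = normClassGroup K L := by
  rw [hω.toIsCompatibleSystem.comap_theta_abelianizedFixingSubgroup L, hω.ker_eq L]

/-- **Norm groups are open**, given the existence theorem (7.8) in its printed form ("the norm
groups of `C_K` are precisely the closed subgroups of finite index"): a closed subgroup of finite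
index of a topological group is open. [cite: Neukirch2013, Part III (7.8)] -/
theorem isOpen_normClassGroup
    (hET : ∀ N : Subgroup (ideleGroup K ⧸ principalIdeles K),
      (∃ (L : IntermediateField K (AlgebraicClosure K)) (_ : FiniteDimensional K L)
          (_ : IsAbelianGalois K L), normClassGroup K L = N) ↔
        IsClosed (N : Set (ideleGroup K ⧸ principalIdeles K)) ∧ N.FiniteIndex)
    (L : IntermediateField K (AlgebraicClosure K)) [FiniteDimensional K L] [IsAbelianGalois K L] :
    IsOpen (normClassGroup K L : Set (ideleGroup K ⧸ principalIdeles K)) := by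
  obtain ⟨hclosed, hfi⟩ := (hET (normClassGroup K L)).mp ⟨L, inferInstance, inferInstance, rfl⟩
  haveI := hfi
  exact Subgroup.isOpen_of_isClosed_of_finiteIndex _ hclosed

/-- **`( , K)` is continuous**, given (6.13) and (7.8) (Neukirch, proof of (7.12), p. 184: the
norm groups `𝒩_L = ker ( , L|K)` are open and `( , K)` maps `𝒩_L` into `G(K^ab|L)`).
[cite: Neukirch2013, Part III Thm. (7.12) (proof, p. 184)] -/
theorem continuous_theta (hω : IsGlobalReciprocitySystem K ω)
    (hET : ∀ N : Subgroup (ideleGroup K ⧸ principalIdeles K),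
      (∃ (L : IntermediateField K (AlgebraicClosure K)) (_ : FiniteDimensional K L)
          (_ : IsAbelianGalois K L), normClassGroup K L = N) ↔
        IsClosed (N : Set (ideleGroup K ⧸ principalIdeles K)) ∧ N.FiniteIndex) :
    Continuous hω.theta :=
  hω.toIsCompatibleSystem.continuous_theta fun L _ _ => by
    rw [hω.ker_eq L]
    exact isOpen_normClassGroup hET L

/-- **Existence theorem in limit form**, given (6.13) and (7.8): every open subgroup `N` of
finite index of `C_K` is `( , K)⁻¹(H)` for an open subgroup `H ≤ G_K^ab` — namely `N` is closed
of finite index, hence a norm group `N_{L|K} C_L = ker ( , L|K)` ((7.8), (6.13)), and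
`ker ( , L|K) = ( , K)⁻¹(G(K^ab|L))` with `G(K^ab|L)` open.
[cite: Neukirch2013, Part III (7.8), (6.13)] -/
theorem exists_isOpen_comap_eq (hω : IsGlobalReciprocitySystem K ω)
    (hET : ∀ N : Subgroup (ideleGroup K ⧸ principalIdeles K),
      (∃ (L : IntermediateField K (AlgebraicClosure K)) (_ : FiniteDimensional K L)
          (_ : IsAbelianGalois K L), normClassGroup K L = N) ↔
        IsClosed (N : Set (ideleGroup K ⧸ principalIdeles K)) ∧ N.FiniteIndex)
    (N : Subgroup (ideleGroup K ⧸ principalIdeles K))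
    (hN : IsOpen (N : Set (ideleGroup K ⧸ principalIdeles K))) (hfi : N.FiniteIndex) :
    ∃ H : Subgroup (absoluteGaloisGroupAbelianization K),
      IsOpen (H : Set (absoluteGaloisGroupAbelianization K)) ∧ H.comap hω.theta = N := by
  obtain ⟨L, hLfin, hLab, hLN⟩ := (hET N).mpr ⟨Subgroup.isClosed_of_isOpen N hN, hfi⟩
  haveI := hLfin
  haveI := hLab
  exact ⟨abelianizedFixingSubgroup K L, isOpen_abelianizedFixingSubgroup L,
    (hω.comap_theta_eq_normClassGroup L).trans hLN⟩

/-- **The Artin map in limit form from (6.13) and (7.8)** (universe-polymorphic): the universal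
norm residue symbol `( , K) = lim ( , L|K) : C_K →* Γ_K^ab` is continuous, has dense range, and
pulls the open subgroups of `Γ_K^ab` back onto all open subgroups of finite index of `C_K`.
[cite: Neukirch2013, Part III §6 p. 169–170, (7.8), Thm. (7.12) (proof, p. 184)] -/
theorem artinMapLimitForm (hω : IsGlobalReciprocitySystem K ω)
    (hET : ∀ N : Subgroup (ideleGroup K ⧸ principalIdeles K),
      (∃ (L : IntermediateField K (AlgebraicClosure K)) (_ : FiniteDimensional K L)
          (_ : IsAbelianGalois K L), normClassGroup K L = N) ↔
        IsClosed (N : Set (ideleGroup K ⧸ principalIdeles K)) ∧ N.FiniteIndex) :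
    Continuous hω.theta ∧ DenseRange hω.theta ∧
      ∀ N : Subgroup (ideleGroup K ⧸ principalIdeles K),
        IsOpen (N : Set (ideleGroup K ⧸ principalIdeles K)) → N.FiniteIndex →
          ∃ H : Subgroup (absoluteGaloisGroupAbelianization K),
            IsOpen (H : Set (absoluteGaloisGroupAbelianization K)) ∧ H.comap hω.theta = N :=
  ⟨hω.continuous_theta hET, hω.denseRange_theta, hω.exists_isOpen_comap_eq hET⟩

/-- **(7.12) for the universal norm residue symbol, from (6.13) and (7.8)** (universe-polymorphic
form, with the two topological inputs of Neukirch's proof as hypotheses, cf.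
`IsGlobalReciprocityMap.of_denseRange`): if `C_K = S · D` with `S` compact and `D` infinitely
divisible ((7.4), (7.6)) and a class in every open finite-index subgroup is infinitely divisible
(first half of the proof of (7.12)), then `( , K) = lim ( , L|K)` is a global reciprocity map.
[cite: Neukirch2013, Part III Thm. (7.12) (proof, p. 182–184)] -/
theorem isGlobalReciprocityMap_theta' (hω : IsGlobalReciprocitySystem K ω)
    (hET : ∀ N : Subgroup (ideleGroup K ⧸ principalIdeles K),
      (∃ (L : IntermediateField K (AlgebraicClosure K)) (_ : FiniteDimensional K L)
          (_ : IsAbelianGalois K L), normClassGroup K L = N) ↔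
        IsClosed (N : Set (ideleGroup K ⧸ principalIdeles K)) ∧ N.FiniteIndex)
    (hdecomp : ∃ S : Set (ideleGroup K ⧸ principalIdeles K), IsCompact S ∧
      ∀ a : ideleGroup K ⧸ principalIdeles K, ∃ s ∈ S, ∃ d : ideleGroup K ⧸ principalIdeles K,
        (∀ n : ℕ, 0 < n → ∃ b : ideleGroup K ⧸ principalIdeles K, b ^ n = d) ∧ a = s * d)
    (hdiv : ∀ a : ideleGroup K ⧸ principalIdeles K,
      (∀ N : Subgroup (ideleGroup K ⧸ principalIdeles K),
        IsOpen (N : Set (ideleGroup K ⧸ principalIdeles K)) → N.FiniteIndex → a ∈ N) →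
      ∀ n : ℕ, 0 < n → ∃ b : ideleGroup K ⧸ principalIdeles K, b ^ n = a) :
    IsGlobalReciprocityMap K hω.theta :=
  IsGlobalReciprocityMap.of_denseRange (hω.continuous_theta hET) hω.denseRange_theta hdecomp
    (hω.exists_isOpen_comap_eq hET) hdiv

/-- **Neukirch III (7.12) from (6.13) and (7.8)** (`K : Type`).  Given norm residue symbols
`( , L|K) : C_K → G(L|K)` for the finite abelian `L ⊆ K̄` — surjective with kernel `N_{L|K} C_L`
and compatible in towers ((6.13) with a)) — and the existence theorem (7.8) ("the norm groups of
`C_K` are precisely the closed subgroups of finite index"), the universal norm residue symbol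
`( , K) = lim ( , L|K) : C_K → G_K^ab` **is a global reciprocity map**: continuous, surjective,
with kernel the infinitely divisible idele classes, and every open subgroup of finite index of
`C_K` the preimage of an open subgroup of `G_K^ab`.  The limit passage (p. 169–170, 184) is this
file; surjectivity and the kernel ((7.12) proper, p. 182–183) are the tree's
`IsGlobalReciprocityMap.of_denseRange₁` (with `C_K = C_K¹ · ℝ₊ˣ`, `C_K¹` compact, and
`Automorphic.IdeleClassGroup.forall_exists_pow_eq_of_forall_mem`).
[cite: Neukirch2013, Part III Thm. (7.12), from (6.13) and (7.8)] -/
theorem isGlobalReciprocityMap_theta {K : Type} [Field K] [NumberField K]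
    {ω : (L : IntermediateField K (AlgebraicClosure K)) →
      (ideleGroup K ⧸ principalIdeles K) →* (L ≃ₐ[K] L)}
    (hω : IsGlobalReciprocitySystem K ω)
    (hET : ∀ N : Subgroup (ideleGroup K ⧸ principalIdeles K),
      (∃ (L : IntermediateField K (AlgebraicClosure K)) (_ : FiniteDimensional K L)
          (_ : IsAbelianGalois K L), normClassGroup K L = N) ↔
        IsClosed (N : Set (ideleGroup K ⧸ principalIdeles K)) ∧ N.FiniteIndex) :
    IsGlobalReciprocityMap K hω.theta :=
  IsGlobalReciprocityMap.of_denseRange₁ (hω.continuous_theta hET) hω.denseRange_theta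
    (hω.exists_isOpen_comap_eq hET)

end IsGlobalReciprocitySystem

/-- **The named fact `exists_isGlobalReciprocityMap K` from the finite-level reciprocity law
(6.13) and the existence theorem (7.8)** (`K : Type`): if there is a system of norm residue
symbols `( , L|K) : C_K → G(L|K)`, `L|K` finite abelian in `K̄`, surjective with kernel
`N_{L|K} C_L` and compatible in towers, and the norm groups of `C_K` are exactly its closed
subgroups of finite index, then the global reciprocity law (7.12) holds for `K` — witnessed by the
universal norm residue symbol `( , K) = lim ( , L|K)`.
[cite: Neukirch2013, Part III Thm. (7.12), (6.13), (7.8)] -/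
theorem exists_isGlobalReciprocityMap_of_isGlobalReciprocitySystem {K : Type} [Field K]
    [NumberField K]
    {ω : (L : IntermediateField K (AlgebraicClosure K)) →
      (ideleGroup K ⧸ principalIdeles K) →* (L ≃ₐ[K] L)}
    (hω : IsGlobalReciprocitySystem K ω)
    (hET : ∀ N : Subgroup (ideleGroup K ⧸ principalIdeles K),
      (∃ (L : IntermediateField K (AlgebraicClosure K)) (_ : FiniteDimensional K L)
          (_ : IsAbelianGalois K L), normClassGroup K L = N) ↔
        IsClosed (N : Set (ideleGroup K ⧸ principalIdeles K)) ∧ N.FiniteIndex) :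
    exists_isGlobalReciprocityMap K :=
  ⟨hω.theta, hω.isGlobalReciprocityMap_theta hET⟩

end NumberField

end Literature.NumberTheory.GaloisRepresentations
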